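import Summits.ResolutionOfSingularities.KangarooAtlas.MizutaniThetaStepIneq
import Summits.ResolutionOfSingularities.KangarooAtlas.MizutaniExtremalTwo
import HarnessLib

/-!
# The extremal point has profile `1, 3, 5, …, 2p − 1` and a coefficient field of degree `p²` (Mizutani 1973, Thm. 2.8, Step (I), all `p`)

Cell `pub-rosobs`, Mizutani enclosure (seat mizutani-encloser-2, gen 7). AI-written; AI review is weaker than expert
review; NOT a resolution-of-singularities theorem (summit relevance C).

Mizutani (Nagoya Math. J. 52 (1973) p. 91, Step (I)): «the sequence of the dimensions of `k·f ⊂ Diff_1(k)f ⊂ ⋯ ⊂ Diff_{p−1}(k)f` is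
necessarily `1, 3, 5, …, 2p − 1` … We put `K = k^p(c(f))`.  Then `[K : k^p] = p²`».  Gen 6 (`MizutaniExtremalTwo.lean`) had this for `p = 2`
only.  For the tower data of an extremal point (`v` with `L`-independent coordinates, `d` independent columns `W_l` through `J^p`, one genuine,
`#ι + 1 = 2p + d`) this file supplies the hypotheses of the step inequality (`MizutaniThetaStepIneq.lean`):

* **`IsRootTower.eq_zero_of_rational_mem_thetaSpan_of_extremal`** — (H): `Θ_{p−1}(v)` has no nonzero `L`-rational vector (else dropping
  that coordinate gives a system in `#ι − 1` coordinates violating `2p + d ≤ #ι + 1`);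
* **`IsRootTower.dual_of_extremal`** — (DUAL): a vector `w ⊥ Θ_{p−1}(v)` lies in `span_K{W_l}` (dimension count), so `Σ v_i ⊗ w_i ∈ J^p`, hence
  `Σ w_i ⊗ v_i ∈ J^p` (flip) and `Θ_{p−1}(w) ⊥ v`;
* **`IsRootTower.finrank_thetaSpan_eq_of_extremal`** — `dim_K Θ_j(v) = 2j + 1` for all `j ≤ p − 1`;
* **`exists_adapted_pair_of_extremal`** — for an extremal point `𝔭` of `ℙ^n_k` (no linear form, `(L_B)_1 ≠ 0`, `n + 2 = 2p + dim (L_B)_1`), ALL `p`: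
  `𝔭 = [c^{1/p}]`, `c_0 = 1`, `c` `k^p`-independent, `{c_i} ⊆ k^p(y_1, y_2)` for a `p`-independent PAIR `y ⊆ {c_i}` («`[K : k^p] = p²`»), inside an
  envelope `k^p(b) ⊇ y` in which `dim Θ_j(c) = 2j + 1` for `j ≤ p − 1` (so `dim Θ_2(c) = 5` for odd `p`).

## References

* H. Mizutani, *Hironaka's additive group schemes*, Nagoya Math. J. 52 (1973) 85–95, proof of Thm. 2.8, Step (I)–(II) (p. 91–92).
  [Mizutani1973HironakaGroupSchemes]
-/

noncomputable section

open MvPolynomial TensorProduct Literature.AlgebraicGeometry.Resolution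
  Literature.AlgebraicGeometry.Resolution.HironakaScheme

namespace Summit.ResolutionOfSingularities.KangarooAtlas.Mizutani

universe u

/-! ## Tower level: (H), (DUAL) and the profile of the extremal configuration -/

section ExtremalTower

variable {L K : Type u} [Field L] [Field K] [Algebra L K] {s p : ℕ} [hp : Fact p.Prime] [CharP K p]
  {x : Fin s → L} {a : Fin s → K} {ι : Type*} [Fintype ι] [DecidableEq ι]

omit [DecidableEq ι] in
/-- In the extremal configuration `dim_K Θ_{p−1}(v) = 2p − 1 = #ι − d`. [cite: Mizutani1973HironakaGroupSchemes, proof of Thm. 2.8, Step (I) («codim_k θ_1(f) = dim_k (k·f)* = 1», dualised)] -/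
theorem IsRootTower.finrank_thetaSpan_sub_one_of_extremal (h : IsRootTower L K (p ^ 1) x a) {v : ι → K} {d : ℕ}
    {W : Fin d → ι → K} (hWind : LinearIndependent K W) (hWJ : ∀ l, pairTensor L (W l) v ∈ KaehlerDifferential.ideal L K ^ p ^ 1)
    {l₀ : Fin d} (hI : pairTensor L (W l₀) v ∉ frobPowerIdeal L p ^ p ^ (1 - 1)) (hcard : Fintype.card ι + 1 = 2 * p + d) :
    Module.finrank K (h.thetaSpan (p - 1) v) = 2 * p - 1 ∧ Module.finrank K (h.thetaSpan (p - 1) v) + d = Fintype.card ι := by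
  have hq : p - 1 + 1 ≤ p ^ 1 := by rw [pow_one]; have := hp.out.one_lt; omega
  have hlow := h.two_mul_pow_le_finrank_thetaSpan_succ v (W l₀) (hWJ l₀) hI
  rw [pow_one] at hlow
  have hup := h.finrank_thetaSpan_add_le_card hq v W hWind hWJ
  omega

/-- **(H) — no rational vector**: in the extremal configuration (`d` independent columns through `J^p`, one genuine, `#ι + 1 = 2p + d`) the span
`Θ_{p−1}(v)` contains no nonzero `L`-rational vector `θ`: otherwise, with `θ(u₀) ≠ 0`, the vectors `v'_u = v_u − (θ_u/θ_{u₀}) v_{u₀}` (`u ≠ u₀`) and the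
restricted columns give the SAME tensors `Σ v'_u ⊗ W_l(u) = Σ v_u ⊗ W_l(u)` in `#ι − 1` coordinates, violating `2p ≤ dim Θ + 1 ≤ #ι' + 1 − d`.
[cite: Mizutani1973HironakaGroupSchemes, proof of Thm. 2.8 («H_f satisfies (iv), hence in particular θ_1(f) ∩ W = {0}»)] -/
theorem IsRootTower.eq_zero_of_rational_mem_thetaSpan_of_extremal (h : IsRootTower L K (p ^ 1) x a) {v : ι → K} {d : ℕ}
    {W : Fin d → ι → K} (hWind : LinearIndependent K W) (hWJ : ∀ l, pairTensor L (W l) v ∈ KaehlerDifferential.ideal L K ^ p ^ 1)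
    {l₀ : Fin d} (hI : pairTensor L (W l₀) v ∉ frobPowerIdeal L p ^ p ^ (1 - 1)) (hcard : Fintype.card ι + 1 = 2 * p + d)
    {θ : ι → K} (hθ : θ ∈ h.thetaSpan (p - 1) v) (hθrat : ∀ i, θ i ∈ (algebraMap L K).range) : θ = 0 := by
  classical
  by_contra hθ0
  obtain ⟨u₀, hu₀⟩ : ∃ u₀, θ u₀ ≠ 0 := by
    by_contra hall; push Not at hall; exact hθ0 (funext hall)
  choose lam hlam using fun i => RingHom.mem_range.mp (hθrat i)
  have hq : p - 1 + 1 ≤ p ^ 1 := by rw [pow_one]; have := hp.out.one_lt; omega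
  have horth : ∀ l, ∑ u, θ u * W l u = 0 := fun l => h.thetaSpan_sum_mul_eq_zero hq v (W l) (hWJ l) hθ
  let ι' := {u : ι // u ≠ u₀}
  have hsplitK : ∀ f : ι → K, ∑ u, f u = f u₀ + ∑ u : ι', f u := fun f => by
    rw [← Finset.add_sum_erase _ _ (Finset.mem_univ u₀),
      Finset.sum_subtype (Finset.univ.erase u₀) (p := fun u => u ≠ u₀) (fun u => by simp)]
  have hsplitT : ∀ f : ι → K ⊗[L] K, ∑ u, f u = f u₀ + ∑ u : ι', f u := fun f => by
    rw [← Finset.add_sum_erase _ _ (Finset.mem_univ u₀),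
      Finset.sum_subtype (Finset.univ.erase u₀) (p := fun u => u ≠ u₀) (fun u => by simp)]
  let cc : ι → L := fun u => lam u / lam u₀
  have hcc : ∀ u, algebraMap L K (cc u) = θ u / θ u₀ := fun u => by
    show algebraMap L K (lam u / lam u₀) = _
    rw [map_div₀, hlam, hlam]
  let v' : ι' → K := fun u => v u - cc u • v u₀
  let R : (ι → K) →ₗ[K] (ι' → K) := LinearMap.funLeft K K ((↑) : ι' → ι)
  have hR : ∀ (w : ι → K) (u : ι'), R w u = w u := fun w u => rfl
  -- `W_l(u₀)` is determined by the other coordinates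
  have hWu₀ : ∀ l, θ u₀ * W l u₀ = -∑ u : ι', θ u * W l u := fun l => by
    have := horth l
    rw [hsplitK] at this
    exact eq_neg_of_add_eq_zero_left this
  have hpair : ∀ l, pairTensor L (R (W l)) v' = pairTensor L (W l) v := by
    intro l
    rw [pairTensor_apply, pairTensor_apply, hsplitT]
    have h1 : ∀ u : ι', v' u ⊗ₜ[L] R (W l) u = v u ⊗ₜ[L] W l u - v u₀ ⊗ₜ[L] (cc u • W l u) := fun u => by
      show (v u - cc u • v u₀) ⊗ₜ[L] W l u = _
      rw [TensorProduct.sub_tmul, TensorProduct.smul_tmul]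
    rw [Finset.sum_congr rfl fun u _ => h1 u, Finset.sum_sub_distrib, ← TensorProduct.tmul_sum]
    have h3 : ∑ u : ι', cc u • W l (u : ι) = -W l u₀ := by
      have : ∑ u : ι', cc u • W l (u : ι) = (θ u₀)⁻¹ * ∑ u : ι', θ u * W l u := by
        rw [Finset.mul_sum]
        refine Finset.sum_congr rfl fun u _ => ?_
        rw [Algebra.smul_def, hcc, div_eq_mul_inv, mul_comm (θ u) (θ u₀)⁻¹, mul_assoc]
      rw [this, ← neg_eq_iff_eq_neg.mpr (hWu₀ l), mul_neg, ← mul_assoc, inv_mul_cancel₀ hu₀, one_mul]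
    rw [h3, TensorProduct.tmul_neg, sub_neg_eq_add, add_comm]
  have hRind : LinearIndependent K (fun l => R (W l)) := by
    refine LinearIndependent.map hWind (f := R) ?_
    rw [Submodule.disjoint_def]
    intro w hw hwker
    rw [LinearMap.mem_ker] at hwker
    -- `w ⊥ θ` since every `W_l` is
    have hwθ : ∑ u, θ u * w u = 0 := by
      set φ : (ι → K) →ₗ[K] K := Fintype.linearCombination K θ with hφ
      have hφapply : ∀ w : ι → K, φ w = ∑ u, θ u * w u := fun w => by
        rw [hφ, Fintype.linearCombination_apply]
        exact Finset.sum_congr rfl fun u _ => by rw [smul_eq_mul, mul_comm]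
      have hle : Submodule.span K (Set.range W) ≤ LinearMap.ker φ := by
        rw [Submodule.span_le]
        rintro _ ⟨l, rfl⟩
        rw [SetLike.mem_coe, LinearMap.mem_ker, hφapply]
        exact horth l
      have := hle hw
      rwa [LinearMap.mem_ker, hφapply] at this
    have hw' : ∀ u : ι', w u = 0 := fun u => by
      have := congrFun hwker u
      rwa [hR] at this
    rw [hsplitK, Finset.sum_eq_zero (fun u _ => by rw [hw' u, mul_zero]), add_zero] at hwθ
    have hw0 : w u₀ = 0 := (mul_eq_zero.mp hwθ).resolve_left hu₀
    funext u
    by_cases hu : u = u₀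
    · rw [hu, hw0, Pi.zero_apply]
    · exact hw' ⟨u, hu⟩
  have hlow := h.two_mul_pow_le_finrank_thetaSpan_succ v' (R (W l₀)) (by rw [hpair]; exact hWJ l₀)
    (by rw [hpair]; exact hI)
  rw [pow_one] at hlow
  have hup := h.finrank_thetaSpan_add_le_card hq v' (fun l => R (W l)) hRind fun l => by rw [hpair]; exact hWJ l
  have hcard' : Fintype.card ι' < Fintype.card ι :=
    Fintype.card_subtype_lt (p := fun u => u ≠ u₀) (x := u₀) (by simp)
  omega

omit [DecidableEq ι] in
/-- **(DUAL) — the flip symmetry**: in the extremal configuration every vector `w ⊥ Θ_{p−1}(v)` lies in `span_K{W_l}` (dimension count), so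
`Σ v_u ⊗ w_u ∈ J^p`, hence `Σ w_u ⊗ v_u ∈ J^p` and `Θ_{p−1}(w) ⊥ v`. [cite: Mizutani1973HironakaGroupSchemes, Def. 2.2 / Prop. 2.5 (the dual H-scheme H*, (k·f)* and bi-duality)] -/
theorem IsRootTower.dual_of_extremal (h : IsRootTower L K (p ^ 1) x a) {v : ι → K} {d : ℕ}
    {W : Fin d → ι → K} (hWind : LinearIndependent K W) (hWJ : ∀ l, pairTensor L (W l) v ∈ KaehlerDifferential.ideal L K ^ p ^ 1)
    {l₀ : Fin d} (hI : pairTensor L (W l₀) v ∉ frobPowerIdeal L p ^ p ^ (1 - 1)) (hcard : Fintype.card ι + 1 = 2 * p + d)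
    (w : ι → K) (hw : ∀ θ ∈ h.thetaSpan (p - 1) v, ∑ i, w i * θ i = 0) :
    ∀ g ∈ h.thetaSpan (p - 1) w, ∑ i, g i * v i = 0 := by
  classical
  have hq : p - 1 + 1 ≤ p ^ 1 := by rw [pow_one]; have := hp.out.one_lt; omega
  obtain ⟨-, hΘd⟩ := h.finrank_thetaSpan_sub_one_of_extremal hWind hWJ hI hcard
  set Θ := h.thetaSpan (p - 1) v with hΘdef
  haveI := h.thetaSpan_finite (p - 1) v
  set bΘ := Module.finBasis K Θ with hbΘ
  let A : Matrix (Fin (Module.finrank K Θ)) ι K := fun j i => (bΘ j : ι → K) i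
  have hA : ∀ w' j, A.mulVecLin w' j = ∑ i, w' i * (bΘ j : ι → K) i := by
    intro w' j
    rw [Matrix.mulVecLin_apply, Matrix.mulVec, dotProduct]
    exact Finset.sum_congr rfl fun i _ => mul_comm _ _
  -- `rank A = dim Θ`, so `dim ker = d`
  have hrank : Module.finrank K (LinearMap.range A.mulVecLin) = Module.finrank K Θ := by
    change A.rank = _
    rw [Matrix.rank_eq_finrank_span_row]
    have hrows : Submodule.span K (Set.range A.row) = Θ := by
      apply le_antisymm
      · rw [Submodule.span_le]
        rintro _ ⟨j, rfl⟩
        exact (bΘ j).2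
      · intro θ hθ
        have hθeq : θ = ∑ j, bΘ.repr ⟨θ, hθ⟩ j • (bΘ j : ι → K) := by
          conv_lhs => rw [show θ = ((⟨θ, hθ⟩ : Θ) : ι → K) from rfl, ← bΘ.sum_repr ⟨θ, hθ⟩]
          rw [Submodule.coe_sum]
          rfl
        rw [hθeq]
        exact Submodule.sum_mem _ fun j _ => Submodule.smul_mem _ _ (Submodule.subset_span ⟨j, rfl⟩)
    rw [hrows]
  have hker : Module.finrank K (LinearMap.ker A.mulVecLin) = d := by
    have := LinearMap.finrank_range_add_finrank_ker A.mulVecLin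
    rw [hrank, Module.finrank_fintype_fun_eq_card] at this
    omega
  -- `span{W_l} = ker`
  have hWker : Submodule.span K (Set.range W) ≤ LinearMap.ker A.mulVecLin := by
    rw [Submodule.span_le]
    rintro _ ⟨l, rfl⟩
    rw [SetLike.mem_coe, LinearMap.mem_ker]
    funext j
    rw [hA, Pi.zero_apply, Finset.sum_congr rfl fun i _ => mul_comm (W l i) _]
    exact h.thetaSpan_sum_mul_eq_zero hq v (W l) (hWJ l) (bΘ j).2
  have heq : Submodule.span K (Set.range W) = LinearMap.ker A.mulVecLin :=
    Submodule.eq_of_le_of_finrank_eq hWker (by rw [finrank_span_eq_card hWind, Fintype.card_fin, hker])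
  have hwker : w ∈ LinearMap.ker A.mulVecLin := by
    rw [LinearMap.mem_ker]
    funext j
    rw [hA, Pi.zero_apply]
    exact hw _ (bΘ j).2
  rw [← heq, Submodule.mem_span_range_iff_exists_fun] at hwker
  obtain ⟨μ, hμ⟩ := hwker
  -- `Σ v_u ⊗ w_u ∈ J^p`
  have hJ : pairTensor L w v ∈ KaehlerDifferential.ideal L K ^ p ^ 1 := by
    have : pairTensor L w v = ∑ l, (1 ⊗ₜ[L] μ l) * pairTensor L (W l) v := by
      rw [← hμ, pairTensor_apply]
      simp only [Finset.sum_apply, Pi.smul_apply, smul_eq_mul, TensorProduct.tmul_sum]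
      rw [Finset.sum_comm]
      refine Finset.sum_congr rfl fun l _ => ?_
      rw [pairTensor_apply, Finset.mul_sum]
      refine Finset.sum_congr rfl fun i _ => ?_
      rw [Algebra.TensorProduct.tmul_mul_tmul, one_mul]
    rw [this]
    exact Ideal.sum_mem _ fun l _ => Ideal.mul_mem_left _ _ (hWJ l)
  -- flip: `Σ w_u ⊗ v_u ∈ J^p`
  have hJ' : pairTensor L v w ∈ KaehlerDifferential.ideal L K ^ p ^ 1 := by
    have := (comm_mem_ideal_pow_iff (p ^ 1) (pairTensor L w v)).mpr hJ
    rwa [pairTensor_apply, map_sum, show (∑ i, (Algebra.TensorProduct.comm L K K) (v i ⊗ₜ[L] w i)) =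
      ∑ i, w i ⊗ₜ[L] v i from Finset.sum_congr rfl fun i _ => rfl, ← pairTensor_apply] at this
  intro g hg
  exact h.thetaSpan_sum_mul_eq_zero hq w v hJ' hg

/-- **THE PROFILE OF THE EXTREMAL POINT IS `1, 3, 5, …, 2p − 1`** (all `p`): for `v` with `L`-independent coordinates (tower with `K^p ⊆ L`),
`d` independent columns through `J^p`, one genuine, and `#ι + 1 = 2p + d`: `dim_K Θ_j(v) = 2j + 1` for `j ≤ p − 1`.
[cite: Mizutani1973HironakaGroupSchemes, proof of Thm. 2.8, Step (I) (p. 91: «necessarily 1, 3, 5, …, 2p − 1»)] -/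
theorem IsRootTower.finrank_thetaSpan_eq_of_extremal (h : IsRootTower L K (p ^ 1) x a)
    (hKp : ∀ y : K, y ^ p ∈ (algebraMap L K).range) {v : ι → K} (hvind : LinearIndependent L v) {d : ℕ}
    {W : Fin d → ι → K} (hWind : LinearIndependent K W) (hWJ : ∀ l, pairTensor L (W l) v ∈ KaehlerDifferential.ideal L K ^ p ^ 1)
    {l₀ : Fin d} (hI : pairTensor L (W l₀) v ∉ frobPowerIdeal L p ^ p ^ (1 - 1)) (hcard : Fintype.card ι + 1 = 2 * p + d)
    {j : ℕ} (hj : j ≤ p - 1) : Module.finrank K (h.thetaSpan j v) = 2 * j + 1 := by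
  obtain ⟨htop, hΘd⟩ := h.finrank_thetaSpan_sub_one_of_extremal hWind hWJ hI hcard
  have hd : 0 < d := Fin.pos l₀
  have hne : Nonempty ι := Fintype.card_pos_iff.mp (by have := hp.out.two_le; omega)
  obtain ⟨i₀⟩ := hne
  have hv : v ≠ 0 := fun h0 => hvind.ne_zero i₀ (congrFun h0 i₀)
  exact h.finrank_thetaSpan_eq_of_eq hKp hvind hv
    (fun θ hθ hrat => h.eq_zero_of_rational_mem_thetaSpan_of_extremal hWind hWJ hI hcard hθ hrat)
    (fun w hw => h.dual_of_extremal hWind hWJ hI hcard w hw) (by omega) htop hj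

end ExtremalTower

/-! ## Point level: the extremal point and its adapted pair `y_1, y_2` -/

section Point

variable (k : Type u) [Field k] (p : ℕ) [hp : Fact p.Prime] [CharP k p] {n : ℕ}
  (𝔭 : Ideal (MvPolynomial (Fin (n + 1)) k))

/-- **`[k^p(c) : k^p] = p²` AND THE PROFILE `1, 3, 5, …, 2p − 1` FOR THE EXTREMAL POINT (all `p`)**: a point `𝔭` of `ℙ^n_k` through which
no linear form passes, with `(L_B)_1 ≠ 0` and `n + 2 = 2p + dim (L_B)_1`, is `[c^{1/p}]` with `c_0 = 1`, `c` `k^p`-independent, and the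
`c_i` lie in `k^p(y_1, y_2)` for a `p`-independent PAIR `y ⊆ {c_i}`; in a `p`-independent envelope `b ⊇ y` the tower spans have
`dim Θ_j(c) = 2j + 1` for all `j ≤ p − 1` (Mizutani, Step (I): «dim Diff_1(k)f = 3 and dim Diff_2(k)f = 5 … [K : k^p] = p²», on the point side
via the duality `H ↔ H*`). [cite: Mizutani1973HironakaGroupSchemes, proof of Thm. 2.8, Steps (I)–(II) (p. 91–92)] -/
theorem exists_adapted_pair_of_extremal (hP : IsPoint k 𝔭) (h0 : invForms k p 𝔭 0 = ⊥) (hV : invForms k p 𝔭 1 ≠ ⊥)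
    (hdim : n + 2 = 2 * p + Module.finrank k (invForms k p 𝔭 1)) :
    ∃ (c : Fin (n + 1) → k) (y : Fin 2 → k) (s : ℕ) (b : Fin s → k) (hb : PIndep p 1 b) (hc : ∀ i, c i ∈ towerField 1 b),
      c 0 = 1 ∧ LinearIndependent (frobPow k p 1) c ∧ 𝔭 = ratPoint k p 1 c ∧ PIndep p 1 y ∧ Set.range y ⊆ Set.range c ∧
      Set.range c ⊆ (IntermediateField.adjoin (frobPow k p 1) (Set.range y) : Set k) ∧ Set.range y ⊆ Set.range b ∧
      ∀ j ≤ p - 1, Module.finrank (towerField 1 b)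
        ((isRootTower_adjoin (e := 1) hb).thetaSpan j (fun i => (⟨c i, hc i⟩ : towerField 1 b))) = 2 * j + 1 := by
  classical
  obtain ⟨c, hc0, hcind, heq⟩ := exists_eq_ratPoint_of_extremal k p 𝔭 hP h0 hV hdim
  -- a basis of `V = (L_B)_1`
  set V := invForms k p 𝔭 1 with hVdef
  haveI : FiniteDimensional k V := FiniteDimensional.finiteDimensional_submodule _
  set d := Module.finrank k V with hd
  set bV := Module.finBasis k V with hbV
  set a : Fin d → Fin (n + 1) → k := fun l => (bV l : Fin (n + 1) → k) with ha
  have haind : LinearIndependent k a := bV.linearIndependent.map' V.subtype (Submodule.ker_subtype V)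
  have hdpos : 0 < d := by
    rw [hd]; exact Module.finrank_pos_iff.mpr ((Submodule.nontrivial_iff_ne_bot).mpr hV)
  -- the dual tensors `Σ c_i ⊗ a^{(l)}_i ∈ J^p`
  set K₁ := frobPow k p 1 with hK₁
  have haJ : ∀ l, (∑ i, c i ⊗ₜ[K₁] a l i) ∈ KaehlerDifferential.ideal K₁ k ^ p ^ 1 := by
    intro l
    have hmem : a l ∈ invForms k p (ratPoint k p 1 c) 1 := by rw [← heq]; exact (bV l).2
    rw [mem_invForms_ratPoint_iff_zero] at hmem
    have := (comm_mem_ideal_pow_iff (p ^ 1) (∑ i, a l i ⊗ₜ[K₁] c i)).mpr hmem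
    rwa [map_sum, show (∑ i, (Algebra.TensorProduct.comm K₁ k k) (a l i ⊗ₜ[K₁] c i)) = ∑ i, c i ⊗ₜ[K₁] a l i from
      Finset.sum_congr rfl fun i _ => rfl] at this
  -- a `p`-basis `y` of `k^p(c)` inside `{c_i}`, and an envelope `b ⊇ y` containing everything
  obtain ⟨r, y, hy, hyc, hcy⟩ := exists_pIndep_range_subset_adjoin (p := p) (Finset.univ.image c)
  have hY : ∀ l, ∃ Y : Finset k, Realised K₁ Y (p ^ 1) (∑ i, c i ⊗ₜ[K₁] a l i) :=
    fun l => exists_finset_realised_pow (K := K₁) (p ^ 1) (haJ l)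
  choose Yw hYw using hY
  set Y' : Finset k := Finset.univ.biUnion Yw ∪ Finset.univ.image c ∪
    Finset.univ.image (fun li : Fin d × Fin (n + 1) => a li.1 li.2) with hY'
  obtain ⟨s, b, hb, hyb, hY'F⟩ := exists_pIndep_extend_adjoin (p := p) 1 Y' y hy
  have hcF : ∀ i, c i ∈ towerField 1 b := fun i => hY'F (by
    rw [hY', Finset.coe_union, Finset.coe_union]; exact Or.inl (Or.inr (by simp)))
  have haF : ∀ l i, a l i ∈ towerField 1 b := fun l i => hY'F (by
    rw [hY', Finset.coe_union]
    exact Or.inr (by simp only [Finset.coe_image, Finset.coe_univ, Set.image_univ, Set.mem_range]; exact ⟨(l, i), rfl⟩))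
  have hYF : ∀ l, (↑(Yw l) : Set k) ⊆ (towerField 1 b : Set k) := fun l =>
    Set.Subset.trans (Finset.coe_subset.mpr ((Finset.subset_biUnion_of_mem Yw (Finset.mem_univ l)).trans
      (Finset.subset_union_left.trans Finset.subset_union_left))) hY'F
  set h := isRootTower_adjoin (k := k) (p := p) (e := 1) hb with hh
  -- the data in `F = k^p(b)`
  set v : Fin (n + 1) → towerField 1 b := fun i => ⟨c i, hcF i⟩ with hv
  set W : Fin d → Fin (n + 1) → towerField 1 b := fun l i => ⟨a l i, haF l i⟩ with hW
  have hmap : ∀ l, tensorIncl K₁ (towerField 1 b) (pairTensor K₁ (W l) v) = ∑ i, c i ⊗ₜ[K₁] a l i := by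
    intro l
    rw [pairTensor_apply, map_sum]
    exact Finset.sum_congr rfl fun i _ => by rw [Algebra.TensorProduct.map_tmul]; rfl
  have hWJ : ∀ l, pairTensor K₁ (W l) v ∈ KaehlerDifferential.ideal K₁ (towerField 1 b) ^ p ^ 1 := by
    intro l
    obtain ⟨ω₂, hω₂J, hω₂eq⟩ := ((realised_iff K₁).mp (hYw l)) (towerField 1 b) (hYF l)
    have : ω₂ = pairTensor K₁ (W l) v := tensorIncl_injective K₁ (towerField 1 b) (hω₂eq.trans (hmap l).symm)
    rw [← this]; exact hω₂J
  -- independence inside `F`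
  have hvind : LinearIndependent K₁ v :=
    LinearIndependent.of_comp ((towerField 1 b).val.toLinearMap.restrictScalars K₁) (by exact hcind)
  have haind' : LinearIndependent (towerField 1 b) a :=
    haind.restrict_scalars' (towerField 1 b)
  have hWind : LinearIndependent (towerField 1 b) W := by
    let φ : (Fin (n + 1) → towerField 1 b) →ₗ[towerField 1 b] (Fin (n + 1) → k) :=
      { toFun := fun g i => (g i : k)
        map_add' := fun g g' => by funext i; rfl
        map_smul' := fun t g => by funext i; rfl }
    exact LinearIndependent.of_comp φ (by exact haind')
  -- genuineness of the first dual tensor: `I_S = 0` at `e = 1`, and `Σ c_i ⊗ a_i ≠ 0`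
  set l₀ : Fin d := ⟨0, hdpos⟩ with hl₀
  have ha0 : a l₀ ≠ 0 := haind.ne_zero l₀
  have hW0 : W l₀ ≠ 0 := by
    intro hz
    apply ha0
    funext i
    have := congrFun hz i
    rw [hW] at this
    exact congrArg Subtype.val this
  have hI : pairTensor K₁ (W l₀) v ∉ frobPowerIdeal K₁ p ^ p ^ (1 - 1) := by
    rw [Nat.sub_self, pow_zero, pow_one, frobPowerIdeal_towerField_eq_bot, Ideal.mem_bot, pairTensor_apply]
    exact sum_tmul_ne_zero_of_linearIndependent hvind hW0
  -- `K^p ⊆ L` for the tower `k^p(b) ⊇ k^p`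
  have hKp : ∀ z : towerField 1 b, z ^ p ∈ (algebraMap K₁ (towerField 1 b)).range := by
    intro z
    have hz : ((z : k) ^ p) ∈ frobPow k p 1 := by
      have := pow_mem_frobPow (p := p) 1 (z : k)
      rwa [pow_one] at this
    refine ⟨⟨(z : k) ^ p, hz⟩, Subtype.ext ?_⟩
    simp
    rfl
  have hcard : Fintype.card (Fin (n + 1)) + 1 = 2 * p + d := by rw [Fintype.card_fin]; omega
  -- THE PROFILE
  have hprof : ∀ j ≤ p - 1, Module.finrank (towerField 1 b) (h.thetaSpan j v) = 2 * j + 1 :=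
    fun j hj => h.finrank_thetaSpan_eq_of_extremal hKp hvind hWind hWJ hI hcard hj
  -- the adapted count `dim Θ_1(c) = #Y + 1`, hence `r = 2`
  set Yidx : Finset (Fin s) := Finset.univ.filter fun l => b l ∈ Set.range y with hYidx
  have hbinj : Function.Injective b := GenAtt.injective_of_pIndep hb
  have hyinj : Function.Injective y := GenAtt.injective_of_pIndep hy
  have himage : ((↑) : towerField 1 b → k) '' (towerGen 1 b '' (Yidx : Set (Fin s))) = Set.range y := by
    ext z
    simp only [Set.mem_image, Finset.mem_coe, hYidx, Finset.mem_filter, Finset.mem_univ, true_and, coe_towerGen,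
      exists_exists_and_eq_and]
    constructor
    · rintro ⟨l, hl, rfl⟩; exact hl
    · intro hz
      obtain ⟨l, hl⟩ := hyb hz
      exact ⟨l, hl ▸ hz, hl⟩
  have hadapt : IntermediateField.adjoin K₁ (Set.range v) =
      IntermediateField.adjoin K₁ (towerGen 1 b '' (Yidx : Set (Fin s))) := by
    apply le_antisymm
    · rw [IntermediateField.adjoin_le_iff]
      rintro _ ⟨i, rfl⟩
      rw [SetLike.mem_coe, mem_adjoin_intermediateField_iff, himage]
      show c i ∈ IntermediateField.adjoin K₁ (Set.range y)
      exact hcy (Finset.mem_coe.mpr (Finset.mem_image_of_mem c (Finset.mem_univ i)))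
    · rw [IntermediateField.adjoin_le_iff]
      rintro _ ⟨l, hl, rfl⟩
      have hl' : b l ∈ Set.range y := (Finset.mem_filter.mp (Finset.mem_coe.mp hl)).2
      obtain ⟨i, -, hi⟩ := Finset.mem_image.mp (Finset.mem_coe.mp (hyc hl'))
      have : towerGen 1 b l = v i := Subtype.ext (by rw [coe_towerGen, hv]; exact hi.symm)
      rw [this]
      exact IntermediateField.subset_adjoin _ _ ⟨i, rfl⟩
  have hv0 : v 0 = 1 := Subtype.ext (by rw [hv]; exact hc0)
  have hcount := h.finrank_thetaSpan_one le_rfl v hv0 Yidx hadapt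
  have hcardY : Yidx.card = r := by
    have h1 : (Yidx.image b).card = Yidx.card := Finset.card_image_of_injective _ hbinj
    have h2 : Yidx.image b = Finset.univ.image y := by
      ext z
      simp only [Finset.mem_image, hYidx, Finset.mem_filter, Finset.mem_univ, true_and, Set.mem_range]
      constructor
      · rintro ⟨l, ⟨j, hj⟩, rfl⟩; exact ⟨j, hj⟩
      · rintro ⟨j, rfl⟩
        obtain ⟨l, hl⟩ := hyb ⟨j, rfl⟩
        exact ⟨l, ⟨j, hl.symm⟩, hl⟩
    rw [← h1, h2, Finset.card_image_of_injective _ hyinj, Finset.card_univ, Fintype.card_fin]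
  have hr2 : r = 2 := by
    have := hprof 1 (by have := hp.out.two_le; omega)
    rw [hcount, hcardY] at this
    omega
  subst hr2
  refine ⟨c, y, s, b, hb, hcF, hc0, hcind, heq, hy, hyc.trans (by simp), ?_, hyb, hprof⟩
  intro z hz
  exact hcy (by obtain ⟨i, rfl⟩ := hz; simp)

end Point

end Summit.ResolutionOfSingularities.KangarooAtlas.Mizutani

end
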